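import Mathlib
import HarnessLib
import Literature.Analysis.FluidPDE.WholeSpaceIBP

/-!
# Route `PoloidalWindowDoor`, crux `PoloidalWindowRigidity` (stmt-19708), LINE 9 `sonic_cut` (T1/B1): the JACOBIAN NULL LAGRANGIAN under a
# symmetry relation — `∫ χ (∂_p a ∂_q b − ∂_q a ∂_p b) = ∫ a b ∂_q∂_p χ − ½∫ b² ∂_p∂_p χ − ½∫ a² ∂_q∂_q χ` when `∂_p b = ∂_q a`

Seat ns-poloidal-K2-p2 g10 (LEAD-lineage on 19708; file `--supports`).  For the horizontal Jacobian `det ∇ₕvₕ = ∂₀v₀∂₁v₁ − ∂₁v₀∂₀v₁` of a slice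
that is poloidal along `e₃` (`∂₀v₁ = ∂₁v₀`) this is the second-order («two integrations by parts») form of the null Lagrangian `det ∇ₕvₕ` used by
LINE 9's stubs T1 `stub_pairingCollapse` / B1 `stub_balanceDatum` (`Q₃ = det ∇ₕvₕ + ½ tr((Dv)²)` on trace-free poloidal Jacobians; the trace part is
`…RieszCollapse.integral_mul_traceSq_eq_integral_hessian`, p650966).  Stated for scalar `C²` functions `a, b` on a finite-dimensional inner
product space, a `C²` compactly supported weight `χ`, and two vectors `p, q` with `∂_p b = ∂_q a` everywhere; four directional integrations by
parts without boundary (`integral_mul_fderiv_apply_eq_neg`, from `Literature…WholeSpaceIBP.integral_fderiv_apply_eq_zero`) and the symmetry of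
second derivatives.  Consequence: `|∫ χ det ∇ₕvₕ| ≤ 2‖D²χ‖_∞ ∫_{supp χ} |vₕ|²`, i.e. `O(R⁻²)·(energy in B_{2R}) = O(1/R)` by S1.

WHAT THIS IS NOT: calculus only; no statement about Navier–Stokes (bears_on LADDER-NS N0 via crux 19708, LINE 9). [folklore]
-/

noncomputable section

-- the summit and its single sub-problem share the name (CONVENTIONS §1), as in every Theorems file
set_option linter.dupNamespace false

namespace Summit.NavierStokesRegularity.NavierStokesRegularity.Theorems.PoloidalWindowDoorPoloidalWindowRigidityHorizontalDet

open MeasureTheory Set Function Filter Topology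
open Literature.Analysis Literature.Analysis.FluidPDE

variable {E : Type*} [NormedAddCommGroup E] [InnerProductSpace ℝ E] [FiniteDimensional ℝ E]
  [MeasurableSpace E] [BorelSpace E]

/-! ### Directional integration by parts without boundary -/

omit [FiniteDimensional ℝ E] [MeasurableSpace E] [BorelSpace E] in
/-- Product rule for a directional derivative of a product of real functions. [folklore] -/
theorem fderiv_mul_apply' {f g : E → ℝ} {x : E} (hf : DifferentiableAt ℝ f x) (hg : DifferentiableAt ℝ g x) (w : E) :
    fderiv ℝ (fun y => f y * g y) x w = f x * fderiv ℝ g x w + g x * fderiv ℝ f x w := by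
  change fderiv ℝ (f * g) x w = _
  rw [(hf.hasFDerivAt.mul hg.hasFDerivAt).fderiv]
  simp only [FunLike.coe_add, FunLike.coe_smul, Pi.add_apply, Pi.smul_apply, smul_eq_mul]

/-- `∫ f ∂_w g = −∫ g ∂_w f` for `f ∈ C¹_c`, `g ∈ C¹` (no boundary terms on the whole space). [folklore] -/
theorem integral_mul_fderiv_apply_eq_neg {f g : E → ℝ} (hf : ContDiff ℝ 1 f) (hg : ContDiff ℝ 1 g)
    (hc : HasCompactSupport f) (w : E) :
    ∫ x, f x * fderiv ℝ g x w = -∫ x, g x * fderiv ℝ f x w := by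
  have h0 := integral_fderiv_apply_eq_zero (h := fun x => f x * g x) (hf.mul hg) hc.mul_right w
  have hprod : ∀ x, fderiv ℝ (fun x => f x * g x) x w = f x * fderiv ℝ g x w + g x * fderiv ℝ f x w := fun x =>
    fderiv_mul_apply' (hf.differentiable one_ne_zero x) (hg.differentiable one_ne_zero x) w
  simp_rw [hprod] at h0
  have hi1 : Integrable fun x => f x * fderiv ℝ g x w :=
    (hf.continuous.mul ((hg.continuous_fderiv one_ne_zero).clm_apply continuous_const)).integrable_of_hasCompactSupport
      hc.mul_right
  have hi2 : Integrable fun x => g x * fderiv ℝ f x w :=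
    (hg.continuous.mul ((hf.continuous_fderiv one_ne_zero).clm_apply continuous_const)).integrable_of_hasCompactSupport
      (hc.fderiv_apply (𝕜 := ℝ) w).mul_left
  rw [integral_add hi1 hi2] at h0
  linarith

/-- `∫ (∂_w χ)·(a ∂_w a) = −½ ∫ a² ∂_w∂_w χ` (`a ∂_w a = ∂_w(½a²)`), for `a ∈ C¹`, `χ ∈ C²_c`. [folklore] -/
theorem integral_fderiv_apply_mul_mul_fderiv_apply {a χ : E → ℝ} (ha : ContDiff ℝ 1 a) (hχ : ContDiff ℝ 2 χ)
    (hχc : HasCompactSupport χ) (w : E) :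
    ∫ x, fderiv ℝ χ x w * (a x * fderiv ℝ a x w) = -(1 / 2) * ∫ x, a x ^ 2 * fderiv ℝ (fun y => fderiv ℝ χ y w) x w := by
  have hχ1 : ContDiff ℝ 1 fun y => fderiv ℝ χ y w := (hχ.fderiv_right (m := 1) le_rfl).clm_apply contDiff_const
  have hsq : ContDiff ℝ 1 fun x => 1 / 2 * (a x * a x) := contDiff_const.mul (ha.mul ha)
  have hd : ∀ x, fderiv ℝ (fun x => 1 / 2 * (a x * a x)) x w = a x * fderiv ℝ a x w := by
    intro x
    have hda : HasFDerivAt a (fderiv ℝ a x) x := (ha.differentiable one_ne_zero x).hasFDerivAt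
    change fderiv ℝ (fun y => (1 / 2 : ℝ) * (a * a) y) x w = _
    rw [((hda.mul hda).const_mul (1 / 2 : ℝ)).fderiv]
    simp only [FunLike.coe_add, FunLike.coe_smul, Pi.add_apply, Pi.smul_apply, smul_eq_mul]
    ring
  have h := integral_mul_fderiv_apply_eq_neg hχ1 hsq (hχc.fderiv_apply (𝕜 := ℝ) w) w
  simp_rw [hd] at h
  rw [h, ← integral_neg, ← integral_const_mul]
  exact integral_congr_ae (Eventually.of_forall fun x => by ring)

/-! ### The Jacobian null Lagrangian -/

/-- **THE JACOBIAN NULL LAGRANGIAN UNDER `∂_p b = ∂_q a`.**  For `C²` scalar functions `a, b`, a `C²` compactly supported weight `χ`,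
and vectors `p, q` with `∂_p b = ∂_q a` everywhere:
`∫ χ (∂_p a ∂_q b − ∂_q a ∂_p b) = ∫ a b ∂_q∂_p χ − ½ ∫ b² ∂_p∂_p χ − ½ ∫ a² ∂_q∂_q χ`. [folklore] -/
theorem integral_mul_jacobian_eq {a b χ : E → ℝ} (ha : ContDiff ℝ 2 a) (hb : ContDiff ℝ 2 b) (hχ : ContDiff ℝ 2 χ)
    (hχc : HasCompactSupport χ) {p q : E} (hsym : ∀ x, fderiv ℝ b x p = fderiv ℝ a x q) :
    ∫ x, χ x * (fderiv ℝ a x p * fderiv ℝ b x q - fderiv ℝ a x q * fderiv ℝ b x p) =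
      (∫ x, a x * b x * fderiv ℝ (fun y => fderiv ℝ χ y p) x q)
        - 1 / 2 * (∫ x, b x ^ 2 * fderiv ℝ (fun y => fderiv ℝ χ y p) x p)
        - 1 / 2 * (∫ x, a x ^ 2 * fderiv ℝ (fun y => fderiv ℝ χ y q) x q) := by
  have ha1 : ContDiff ℝ 1 a := ha.of_le (by norm_num)
  have hb1 : ContDiff ℝ 1 b := hb.of_le (by norm_num)
  have hχ1 : ContDiff ℝ 1 χ := hχ.of_le (by norm_num)
  have hDa : ∀ u : E, ContDiff ℝ 1 fun x => fderiv ℝ a x u := fun u => (ha.fderiv_right (m := 1) le_rfl).clm_apply contDiff_const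
  have hDb : ∀ u : E, ContDiff ℝ 1 fun x => fderiv ℝ b x u := fun u => (hb.fderiv_right (m := 1) le_rfl).clm_apply contDiff_const
  have hDχ : ∀ u : E, ContDiff ℝ 1 fun x => fderiv ℝ χ x u := fun u => (hχ.fderiv_right (m := 1) le_rfl).clm_apply contDiff_const
  have hDχc : ∀ u : E, HasCompactSupport fun x => fderiv ℝ χ x u := fun u => hχc.fderiv_apply (𝕜 := ℝ) u
  have ca : Continuous a := ha.continuous
  have cb : Continuous b := hb.continuous
  have cχ : Continuous χ := hχ.continuous
  have cDa : ∀ u, Continuous fun x => fderiv ℝ a x u := fun u => (hDa u).continuous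
  have cDb : ∀ u, Continuous fun x => fderiv ℝ b x u := fun u => (hDb u).continuous
  have cDχ : ∀ u, Continuous fun x => fderiv ℝ χ x u := fun u => (hDχ u).continuous
  have cDDb : ∀ u u', Continuous fun x => fderiv ℝ (fun y => fderiv ℝ b y u) x u' := fun u u' =>
    ((hDb u).continuous_fderiv one_ne_zero).clm_apply continuous_const
  have cDDχ : ∀ u u', Continuous fun x => fderiv ℝ (fun y => fderiv ℝ χ y u) x u' := fun u u' =>
    ((hDχ u).continuous_fderiv one_ne_zero).clm_apply continuous_const
  -- mixed second derivatives of `b` are symmetric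
  have hmixed : ∀ x, fderiv ℝ (fun y => fderiv ℝ b y q) x p = fderiv ℝ (fun y => fderiv ℝ b y p) x q := by
    intro x
    have hd : DifferentiableAt ℝ (fderiv ℝ b) x := ((hb.fderiv_right (m := 1) le_rfl).differentiable one_ne_zero) x
    rw [fderiv_clm_apply hd (differentiableAt_const q), fderiv_clm_apply hd (differentiableAt_const p)]
    simp only [fderiv_fun_const, Pi.zero_apply, ContinuousLinearMap.comp_zero, zero_add, ContinuousLinearMap.flip_apply]
    exact (hb.contDiffAt.isSymmSndFDerivAt (by simp)) p q
  -- integrability of the pieces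
  have I1 : ∀ u u', Integrable fun x => a x * (χ x * fderiv ℝ (fun y => fderiv ℝ b y u) x u') := fun u u' =>
    (ca.mul (cχ.mul (cDDb u u'))).integrable_of_hasCompactSupport hχc.mul_right.mul_left
  have I2 : ∀ u u', Integrable fun x => a x * (fderiv ℝ b x u * fderiv ℝ χ x u') := fun u u' =>
    (ca.mul ((cDb u).mul (cDχ u'))).integrable_of_hasCompactSupport (hDχc u').mul_left.mul_left
  have I3 : Integrable fun x => b x * (a x * fderiv ℝ (fun y => fderiv ℝ χ y p) x q) :=
    (cb.mul (ca.mul (cDDχ p q))).integrable_of_hasCompactSupport ((hDχc p).fderiv_apply (𝕜 := ℝ) q).mul_left.mul_left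
  have I4 : Integrable fun x => b x * (fderiv ℝ χ x p * fderiv ℝ a x q) :=
    (cb.mul ((cDχ p).mul (cDa q))).integrable_of_hasCompactSupport (hDχc p).mul_right.mul_left
  -- Step 1 (first integration by parts, `∂_{u'}` off `a`): `∫ χ ∂_{u'}a ∂_u b = −M − ∫ a ∂_u b ∂_{u'}χ`
  have hS : ∀ u u' : E, ∫ x, χ x * (fderiv ℝ a x u' * fderiv ℝ b x u) =
      -(∫ x, a x * (χ x * fderiv ℝ (fun y => fderiv ℝ b y u) x u')) - ∫ x, a x * (fderiv ℝ b x u * fderiv ℝ χ x u') := by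
    intro u u'
    have h := integral_mul_fderiv_apply_eq_neg (hχ1.mul (hDb u)) ha1 hχc.mul_right u'
    have e1 : (fun x => χ x * fderiv ℝ b x u * fderiv ℝ a x u') = fun x => χ x * (fderiv ℝ a x u' * fderiv ℝ b x u) := by
      funext x; ring
    have e2 : (fun x => a x * fderiv ℝ (fun y => χ y * fderiv ℝ b y u) x u') =
        fun x => a x * (χ x * fderiv ℝ (fun y => fderiv ℝ b y u) x u') + a x * (fderiv ℝ b x u * fderiv ℝ χ x u') := by
      funext x
      rw [fderiv_mul_apply' (hχ1.differentiable one_ne_zero x) ((hDb u).differentiable one_ne_zero x)]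
      ring
    rw [e1] at h
    rw [h, e2, integral_add (I1 u u') (I2 u u')]
    ring
  -- Step 2 (`∂_q` off `b`): `∫ ∂_pχ · a · ∂_q b = −N − W`
  have hT : ∫ x, a x * (fderiv ℝ b x q * fderiv ℝ χ x p) =
      -(∫ x, b x * (a x * fderiv ℝ (fun y => fderiv ℝ χ y p) x q)) - ∫ x, b x * (fderiv ℝ χ x p * fderiv ℝ a x q) := by
    have h := integral_mul_fderiv_apply_eq_neg (ha1.mul (hDχ p)) hb1 (hDχc p).mul_left q
    have e1 : (fun x => a x * fderiv ℝ χ x p * fderiv ℝ b x q) = fun x => a x * (fderiv ℝ b x q * fderiv ℝ χ x p) := by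
      funext x; ring
    have e2 : (fun x => b x * fderiv ℝ (fun y => a y * fderiv ℝ χ y p) x q) =
        fun x => b x * (a x * fderiv ℝ (fun y => fderiv ℝ χ y p) x q) + b x * (fderiv ℝ χ x p * fderiv ℝ a x q) := by
      funext x
      rw [fderiv_mul_apply' (ha1.differentiable one_ne_zero x) ((hDχ p).differentiable one_ne_zero x)]
      ring
    rw [e1] at h
    rw [h, e2, integral_add I3 I4]
    ring
  -- the half squares (symmetry relation used here)
  have hVq : ∫ x, a x * (fderiv ℝ b x p * fderiv ℝ χ x q) = -(1 / 2) * ∫ x, a x ^ 2 * fderiv ℝ (fun y => fderiv ℝ χ y q) x q := by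
    rw [← integral_fderiv_apply_mul_mul_fderiv_apply ha1 hχ hχc q]
    exact integral_congr_ae (Eventually.of_forall fun x => by beta_reduce; rw [hsym x]; ring)
  have hWp : ∫ x, b x * (fderiv ℝ χ x p * fderiv ℝ a x q) = -(1 / 2) * ∫ x, b x ^ 2 * fderiv ℝ (fun y => fderiv ℝ χ y p) x p := by
    rw [← integral_fderiv_apply_mul_mul_fderiv_apply hb1 hχ hχc p]
    exact integral_congr_ae (Eventually.of_forall fun x => by beta_reduce; rw [← hsym x]; ring)
  have hNP : ∫ x, b x * (a x * fderiv ℝ (fun y => fderiv ℝ χ y p) x q) = ∫ x, a x * b x * fderiv ℝ (fun y => fderiv ℝ χ y p) x q :=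
    integral_congr_ae (Eventually.of_forall fun x => by ring)
  have hM : ∫ x, a x * (χ x * fderiv ℝ (fun y => fderiv ℝ b y q) x p) = ∫ x, a x * (χ x * fderiv ℝ (fun y => fderiv ℝ b y p) x q) :=
    integral_congr_ae (Eventually.of_forall fun x => by beta_reduce; rw [hmixed x])
  -- the left-hand side splits
  have hL : ∫ x, χ x * (fderiv ℝ a x p * fderiv ℝ b x q - fderiv ℝ a x q * fderiv ℝ b x p) =
      (∫ x, χ x * (fderiv ℝ a x p * fderiv ℝ b x q)) - ∫ x, χ x * (fderiv ℝ a x q * fderiv ℝ b x p) := by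
    rw [← integral_sub]
    · exact integral_congr_ae (Eventually.of_forall fun x => by ring)
    · exact (cχ.mul ((cDa p).mul (cDb q))).integrable_of_hasCompactSupport hχc.mul_right
    · exact (cχ.mul ((cDa q).mul (cDb p))).integrable_of_hasCompactSupport hχc.mul_right
  rw [hL]
  linarith [hS q p, hS p q, hT, hVq, hWp, hNP, hM]

end Summit.NavierStokesRegularity.NavierStokesRegularity.Theorems.PoloidalWindowDoorPoloidalWindowRigidityHorizontalDet

end
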